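/-
Copyright (c) 2026 the pub-hodgecm-mathlib formalisation cell (harness21).  Prover seat hodgecm-mathlib-K2E1-p10 (g0), Track B ∕ K2-LIT, h413 = `stmt-HodgeConjecture-24833`,
line `K2_E1_TraceFormulaBeta`, campaign «EIS-WHITTAKER-3», «C2₃∕C3₃ CONCRETE» FILE F2 (REPORT-FIRST 09:44Z; ORDER CHANGE 09:51Z «F2 after (U3C-c1)»; ★ F3 p859182's letter `hvan`):
THE ψ-TWISTED LOCAL WHITTAKER TOKEN VANISHES AT A GOOD PLACE ABOVE WHICH THE FREQUENCY IS NOT INTEGRAL.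
-/
import Summits.HodgeConjecture.HodgeConjecture.Theorems.K2E1WhittakerLocalCharactersCM          -- ★ (U3C-c1) (K2E2-p12, p859097): `χ_w = ψ_{L,w} ∘ ι_w`, `adeleAddCharAt_quadraticLocalEquiv_mul_apply`
import Summits.HodgeConjecture.HodgeConjecture.Theorems.K2E1IntertwiningLocalFactorU3HeightSplit  -- ★ (3-iii) (K2E2-p12): split pointwise transport `prod_placesOver_max_one_norm_height_eq_gl3_of_split`
import Summits.HodgeConjecture.HodgeConjecture.Theorems.K2E1IntertwiningLocalMeanCMU3            -- ★ (3-iii-b1) (K2E2-p12): `placesOver_good`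
import Summits.HodgeConjecture.HodgeConjecture.Theorems.K2E1WhittakerCoefficientEulerProductU3B   -- ★ B1 (K2E4-p10): the token spelling, `quadraticLocalEquiv_apply_mem_adicCompletionIntegers`
import Summits.HodgeConjecture.HodgeConjecture.Theorems.K2E1WhittakerLocalMeanInertU3Window       -- ★ B-inert window (this seat, p858961): `integral_whittakerInertCell_pi_eq_zero_of_not_mem_left∕right`
import Summits.HodgeConjecture.HodgeConjecture.Theorems.K2E1WhittakerLocalMeanSplitU3             -- ★ B-split (this seat, p858901): `exists_window_splitWhittakerPackage_pi`
import HarnessLib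

/-!
# K2·E1 — `K2E1WhittakerTokenSupportU3` («C2₃ CONCRETE», support): AT A GOOD FINITE PLACE `v` OF `L⁺` THE ψ-TWISTED LOCAL WHITTAKER TOKEN `W_v(ξ, z)` OF `U(2,1)_{L∕L⁺}`
# VANISHES AS SOON AS THE FREQUENCY `ξ` IS NOT INTEGRAL AT SOME PLACE `w ∣ v` — at every `z` for `v` non-split, on the window `{1 < Re z}` for `v` split

Track B ∕ K2-LIT, crux h413 = `stmt-HodgeConjecture-24833`, route of record `HCCMUnconditional`; cell `hodgecm-mathlib`, squad K2, ENGINE E1 (campaign «EIS-WHITTAKER-3»).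
THEOREMS ONLY (no `def`, no `instance`, no notation, no named-fact hypothesis, no `sorry`; default heartbeats); lane `--supports stmt-HodgeConjecture-24833 --as helper` (count-neutral).
Currency of ★ B1∕U3C (the token `W_v(ξw, z) = μ(𝒪_v³)⁻¹ • ∫ Q_v(p)^{−z}·∏_{w∣v} ψ_w(ξw_w·X_w) dμ³`, `X = Ψ_v(p₀,p₁)`), ★ (U3C-c1) `K2E1WhittakerLocalCharactersCM` (`χ_w = ψ_{L,w} ∘ ι_w`), ★ (3-iii)
`K2E1IntertwiningLocalFactorU3Height[Split]` (the pointwise transports of `Q_v` to base coordinates), ★ B-inert `K2E1WhittakerLocalMeanInertU3Window` and ★ B-split `K2E1WhittakerLocalMeanSplitU3`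
(this seat's cells WITH characters on `(Fin 3 → L⁺_v, μ³)`, and their support statements).

THE MATHEMATICS [TateThesis1967, §3.3 and Lemma 4.1.5; Casselman1980, Thm. 3.1; MoeglinWaldspurger1995, I.2.10].  A «good» place: `v` unramified in `L`, `|2|_v = 1`, `δ_w` and `d = δ²` units,
and the local characters `χ_w` of conductor exponent `0` (all cofinitely true, ★ `eventually_hasConductorExp_zero_charComp`).  (§1, `v` NON-SPLIT, one place `w`, `q_w = q_v²`): writing
`ξw_w = Ψ_v(a, b)_w` (`Ψ_v` is onto), ★ (U3C-c1) gives `ψ_w(ξw_w·X_w) = χ_w(p₀a)·χ_w(p₁·db)` (the skew line `ι(L⁺_v)δ` is killed) and ★ (3-iii) gives `Q_v(p) = 𝒲(p)²`, `𝒲 = max(1, max(|p₀|,|p₁|)², |p₂|)`: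
the token's integrand IS ★ B-inert's `𝒲^{−2z}·χ(p₀a)·χ(p₁db)` (§1 `token_integrand_eq_inertCell_of_nonsplit`), whose integral vanishes for EVERY `z` when `a ∉ 𝒪_v` or `db ∉ 𝒪_v` (★ translation by
`Pi.single`); and `ξw_w ∉ 𝒪_w ⟹ a ∉ 𝒪_v ∨ b ∉ 𝒪_v` (★ `quadraticLocalEquiv_apply_mem_adicCompletionIntegers`): **`token_eq_zero_of_nonsplit`**.  (§2, `v` SPLIT, places `w ≠ w̄`, `L_w = L_w̄ = L⁺_v`,
`s = δ_w ∈ L⁺_v`): `X_w = ι_w(p₀ + s p₁)`, `X_w̄ = ι_w̄(p₀ − s p₁)`, `ξw_w = ι_w(a₁)`, `ξw_w̄ = ι_w̄(a₂)` (★ `splitCoord`), `Q_v = A·B` with the two `GL₃` big-cell weights (★ (3-iii) split): the token's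
integrand IS ★ B-split's cell integrand at frequencies `(a₁, −a₂)` (§2 `token_integrand_eq_splitCell_of_split`), and ★ B-split's window package says its normalised integral vanishes on `{1 < Re z}`
when `a₁ ∉ 𝒪_v` or `a₂ ∉ 𝒪_v`, i.e. when `ξw_w ∉ 𝒪_w` or `ξw_w̄ ∉ 𝒪_w̄` (★ `valued_splitCoord`): **`token_eq_zero_of_split`**.  (§3) Both cases: **`token_eq_zero_of_good`**, and the letter shape of
★ F3 `K2E1WhittakerContinuationConcreteU3.exists_whittaker_letters_cm_three_of` at the trivial box: **`token_under_eq_zero_of_not_mem`** — `hvan` at every good place.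
HONEST LABEL: HC_CM is proved only modulo the 7 printed citations (2 remaining named inputs: hLiu418 = `stmt-HodgeConjecture-24832`, h413 = `stmt-HodgeConjecture-24833`)
until rung 0 closes; this file asserts no named fact, closes no socket and crosses no ceiling by itself; count-neutral.
References: [TateThesis1967] J. Tate, *Fourier analysis in number fields*, §3.3, Lemma 4.1.5 · [Casselman1980] W. Casselman, *The unramified principal series of p-adic groups I*,
Compositio Math. 40 (1980), Thm. 3.1 · [MoeglinWaldspurger1995] C. Mœglin, J.-L. Waldspurger, *Spectral Decomposition and Eisenstein Series*, I.2.10.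
-/

set_option autoImplicit false
-- the mandated namespace repeats `HodgeConjecture.HodgeConjecture`, as in every `Theorems/*.lean` of this sub-problem
set_option linter.dupNamespace false

noncomputable section

open MeasureTheory MeasureTheory.Measure NumberField IsDedekindDomain Filter Topology Set
open scoped NNReal ENNReal
open Literature.NumberTheory.Automorphic Literature.NumberTheory.Automorphic.UnitaryGroup Literature.NumberTheory.GaloisRepresentations
open Literature.NumberTheory.GaloisRepresentations.IsNonarchimedeanLocalField Literature.NumberTheory.Automorphic.LocalFieldHaar
open Literature.NumberTheory.GelbartRogawski1991.UnitaryDualPair.LocalSplitting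
open Summit.HodgeConjecture.HodgeConjecture.Cruxes.H413.K2E1IntertwiningLocalFactorU3Height (max_one_norm_height_eq_sq ne_one_of_apply_eq_neg quadraticLocalEquiv_apply_place)
open Summit.HodgeConjecture.HodgeConjecture.Cruxes.H413.K2E1IntertwiningLocalFactorU3HeightSplit (prod_placesOver_max_one_norm_height_eq_gl3_of_split quadraticLocalEquiv_apply_eq_toPlace_of_split
  quadraticLocalEquiv_apply_galInv_eq_toPlace_of_split smul_galInv_ne)
open Summit.HodgeConjecture.HodgeConjecture.Cruxes.H413.K2E1IntertwiningLocalMeanCMU3 (placesOver_good)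
open Summit.HodgeConjecture.HodgeConjecture.Cruxes.H413.K2E1WhittakerLocalCharactersCM
open Summit.HodgeConjecture.HodgeConjecture.Cruxes.H413.K2E1WhittakerCoefficientEulerProductU3B (quadraticLocalEquiv_apply_mem_adicCompletionIntegers)
open Summit.HodgeConjecture.HodgeConjecture.Cruxes.H413.K2E1WhittakerLocalMeanInertU3 (ofReal_sq_cpow)
open Summit.HodgeConjecture.HodgeConjecture.Cruxes.H413.K2E1WhittakerLocalMeanInertU3Window (integral_whittakerInertCell_pi_eq_zero_of_not_mem_left integral_whittakerInertCell_pi_eq_zero_of_not_mem_right)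
open Summit.HodgeConjecture.HodgeConjecture.Cruxes.H413.K2E1WhittakerLocalMeanSplitU3 (exists_window_splitWhittakerPackage_pi)

namespace Summit.HodgeConjecture.HodgeConjecture.Cruxes.H413.K2E1WhittakerTokenSupportU3

variable (L : Type) [Field L] [NumberField L] [IsCMField L] {δ : L} (hcδ : IsCMField.complexConj L δ = -δ) (hδ : δ ≠ 0)
  {d : ↥(maximalRealSubfield L)} (hd : δ * δ = algebraMap ↥(maximalRealSubfield L) L d)
  (v : HeightOneSpectrum (𝓞 ↥(maximalRealSubfield L))) (w : PlacesOver L v)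

/-! ## §0 Balls of exponent `0` in `L⁺_v` are the integers -/

omit [IsCMField L] in
/-- `x ∈ 𝔭_v^0 ↔ v(x) ≤ 1` (★ `mem_primePowBall_adicCompletion_iff`). [folklore] -/
theorem mem_primePowBall_zero_iff (x : v.adicCompletion ↥(maximalRealSubfield L)) :
    x ∈ primePowBall (v.adicCompletion ↥(maximalRealSubfield L)) 0 ↔ Valued.v x ≤ 1 := by
  rw [mem_primePowBall_adicCompletion_iff, neg_zero, WithZero.exp_zero]

/-! ## §1 Non-split places: the token's integrand is ★ B-inert's, and the token vanishes for a non-integral frequency — every `z` -/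

section Nonsplit

include hd in
/-- **THE TOKEN'S INTEGRAND AT A GOOD NON-SPLIT PLACE IS ★ B-INERT'S** (any frequency vector `ξw`; `(a, b) := Ψ_v⁻¹(ξw)`): `Q_v(p)^{−z}·ψ_w(ξw_w X_w) = 𝒲(p)^{−2z}·χ_w(p₀a)·χ_w(p₁·db)`
(★ (U3C-c1) `adeleAddCharAt_quadraticLocalEquiv_mul_apply`, ★ (3-iii) `max_one_norm_height_eq_sq`). [cite: TateThesis1967, §3.3] [cite: MoeglinWaldspurger1995, I.2.10] -/
theorem token_integrand_eq_inertCell_of_nonsplit (hw : IsCMField.complexConj L • w.1 = w.1) (he : v.asIdeal.ramificationIdx' w.1.asIdeal = 1)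
    (h2 : Valued.v (2 : v.adicCompletion ↥(maximalRealSubfield L)) = 1) (hδu : Valued.v (algebraMap L (LocalRing L v) δ w) = 1) (hq : w.1.residueCard = v.residueCard ^ 2)
    (ξw : ∀ w' : PlacesOver L v, w'.1.adicCompletion L) (z : ℂ) (p : Fin 3 → v.adicCompletion ↥(maximalRealSubfield L)) :
    ((((∏ w' : PlacesOver L v, max 1 (max ((normAbs (w'.1.adicCompletion L) (quadraticLocalEquiv L v (IsCMField.complexConj L) hcδ hδ (p 0, p 1) w') : ℝ≥0) : ℝ)
          ((normAbs (w'.1.adicCompletion L) ((toLocalRing L v (p 2) * algebraMap L (LocalRing L v) δ -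
            toLocalRing L v 2⁻¹ * (quadraticLocalEquiv L v (IsCMField.complexConj L) hcδ hδ (p 0, p 1) *
              conjLocal L (IsCMField.complexConj L) v (quadraticLocalEquiv L v (IsCMField.complexConj L) hcδ hδ (p 0, p 1)))) w') : ℝ≥0) : ℝ))) : ℝ) : ℂ) ^ (-z)) *
          (∏ w' : PlacesOver L v, (adeleAddCharAt L w'.1 (ξw w' * quadraticLocalEquiv L v (IsCMField.complexConj L) hcδ hδ (p 0, p 1) w') : ℂ)) =
      ((max 1 (max ((max ((normAbs (v.adicCompletion ↥(maximalRealSubfield L)) (p 0) : ℝ≥0) : ℝ) ((normAbs (v.adicCompletion ↥(maximalRealSubfield L)) (p 1) : ℝ≥0) : ℝ)) ^ 2)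
          ((normAbs (v.adicCompletion ↥(maximalRealSubfield L)) (p 2) : ℝ≥0) : ℝ)) : ℝ) : ℂ) ^ (-(2 * z)) *
        (((adeleAddCharAt L w.1).compAddMonoidHom (toPlace v w : v.adicCompletion ↥(maximalRealSubfield L) →+* w.1.adicCompletion L).toAddMonoidHom (p 0 * ((quadraticLocalEquiv L v (IsCMField.complexConj L) hcδ hδ).symm ξw).1) : Circle) : ℂ) *
        (((adeleAddCharAt L w.1).compAddMonoidHom (toPlace v w : v.adicCompletion ↥(maximalRealSubfield L) →+* w.1.adicCompletion L).toAddMonoidHom (p 1 * ((d : v.adicCompletion ↥(maximalRealSubfield L)) * ((quadraticLocalEquiv L v (IsCMField.complexConj L) hcδ hδ).symm ξw).2)) : Circle) : ℂ) := by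
  haveI : Algebra.IsQuadraticExtension ↥(maximalRealSubfield L) L := IsCMField.isQuadraticExtension L
  haveI : Subsingleton (PlacesOver L v) :=
    PlacesOver.subsingleton_of_smul_eq (IsCMField.complexConj L) (ne_one_of_apply_eq_neg L (IsCMField.complexConj L) hcδ hδ) w hw
  -- the frequency at `w` is `Ψ_v(a, b)_w`
  have hfreq : ξw w = quadraticLocalEquiv L v (IsCMField.complexConj L) hcδ hδ
      (((quadraticLocalEquiv L v (IsCMField.complexConj L) hcδ hδ).symm ξw).1, ((quadraticLocalEquiv L v (IsCMField.complexConj L) hcδ hδ).symm ξw).2) w := by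
    rw [Prod.mk.eta, ContinuousLinearEquiv.apply_symm_apply]
  rw [Fintype.prod_subsingleton _ w, Fintype.prod_subsingleton _ w, hfreq,
    adeleAddCharAt_quadraticLocalEquiv_mul_apply L v w hcδ hδ hd hw, Circle.coe_mul,
    max_one_norm_height_eq_sq L (IsCMField.complexConj L) hcδ hδ hd v w hw he h2 hδu hq (p 0) (p 1) (p 2)]
  have hpos : 0 < (max 1 (max ((max ((normAbs (v.adicCompletion ↥(maximalRealSubfield L)) (p 0) : ℝ≥0) : ℝ) ((normAbs (v.adicCompletion ↥(maximalRealSubfield L)) (p 1) : ℝ≥0) : ℝ)) ^ 2)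
      ((normAbs (v.adicCompletion ↥(maximalRealSubfield L)) (p 2) : ℝ≥0) : ℝ))) := lt_of_lt_of_le one_pos (le_max_left _ _)
  rw [ofReal_sq_cpow hpos, ← Complex.cpow_nat_mul, show ((2 : ℕ) : ℂ) * -z = -(2 * z) by push_cast; ring, mul_assoc]

variable [MeasurableSpace (v.adicCompletion ↥(maximalRealSubfield L))] [BorelSpace (v.adicCompletion ↥(maximalRealSubfield L))]
  (ν : Measure (v.adicCompletion ↥(maximalRealSubfield L))) [ν.IsAddHaarMeasure]

include hd in
/-- **THE TOKEN VANISHES AT A GOOD NON-SPLIT PLACE ABOVE WHICH THE FREQUENCY IS NOT INTEGRAL** — for EVERY `z`: with `(a, b) = Ψ_v⁻¹(ξw)`, `ξw_w ∉ 𝒪_w` forces `a ∉ 𝒪_v` or `b ∉ 𝒪_v`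
(★ `quadraticLocalEquiv_apply_mem_adicCompletionIntegers`), and then ★ B-inert's support (`χ_w` of conductor exponent `0`, `|d|_v = 1`) kills the integral (§1). [cite: TateThesis1967, §3.3, Lemma 4.1.5] -/
theorem token_eq_zero_of_nonsplit (hw : IsCMField.complexConj L • w.1 = w.1) (he : v.asIdeal.ramificationIdx' w.1.asIdeal = 1)
    (h2 : Valued.v (2 : v.adicCompletion ↥(maximalRealSubfield L)) = 1) (hδu : Valued.v (algebraMap L (LocalRing L v) δ w) = 1) (hq : w.1.residueCard = v.residueCard ^ 2)
    (hdu : Valued.v ((d : v.adicCompletion ↥(maximalRealSubfield L))) = 1) (hχ : ((adeleAddCharAt L w.1).compAddMonoidHom (toPlace v w : v.adicCompletion ↥(maximalRealSubfield L) →+* w.1.adicCompletion L).toAddMonoidHom).HasConductorExp 0)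
    (ξw : ∀ w' : PlacesOver L v, w'.1.adicCompletion L) (hξ : ¬ Valued.v (ξw w) ≤ 1) (z : ℂ) :
    ((Measure.pi fun _ : Fin 3 => ν) (integralBox ↥(maximalRealSubfield L) (Fin 3) v)).toReal⁻¹ •
      ∫ p : Fin 3 → v.adicCompletion ↥(maximalRealSubfield L),
        ((((∏ w' : PlacesOver L v, max 1 (max ((normAbs (w'.1.adicCompletion L) (quadraticLocalEquiv L v (IsCMField.complexConj L) hcδ hδ (p 0, p 1) w') : ℝ≥0) : ℝ)
          ((normAbs (w'.1.adicCompletion L) ((toLocalRing L v (p 2) * algebraMap L (LocalRing L v) δ -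
            toLocalRing L v 2⁻¹ * (quadraticLocalEquiv L v (IsCMField.complexConj L) hcδ hδ (p 0, p 1) *
              conjLocal L (IsCMField.complexConj L) v (quadraticLocalEquiv L v (IsCMField.complexConj L) hcδ hδ (p 0, p 1)))) w') : ℝ≥0) : ℝ))) : ℝ) : ℂ) ^ (-z)) *
          (∏ w' : PlacesOver L v, (adeleAddCharAt L w'.1 (ξw w' * quadraticLocalEquiv L v (IsCMField.complexConj L) hcδ hδ (p 0, p 1) w') : ℂ))
        ∂(Measure.pi fun _ : Fin 3 => ν) = 0 := by
  haveI : Algebra.IsQuadraticExtension ↥(maximalRealSubfield L) L := IsCMField.isQuadraticExtension L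
  haveI : Subsingleton (PlacesOver L v) :=
    PlacesOver.subsingleton_of_smul_eq (IsCMField.complexConj L) (ne_one_of_apply_eq_neg L (IsCMField.complexConj L) hcδ hδ) w hw
  set a : v.adicCompletion ↥(maximalRealSubfield L) := ((quadraticLocalEquiv L v (IsCMField.complexConj L) hcδ hδ).symm ξw).1 with ha
  set b : v.adicCompletion ↥(maximalRealSubfield L) := ((quadraticLocalEquiv L v (IsCMField.complexConj L) hcδ hδ).symm ξw).2 with hb
  -- `a ∉ 𝒪_v` or `b ∉ 𝒪_v`
  have hab : ¬ (Valued.v a ≤ 1 ∧ Valued.v b ≤ 1) := by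
    rintro ⟨ha1, hb1⟩
    apply hξ
    have hδu' : ∀ w' : PlacesOver L v, Valued.v (algebraMap L (LocalRing L v) δ w') = 1 := fun w' => by rw [Subsingleton.elim w' w]; exact hδu
    have hmem := quadraticLocalEquiv_apply_mem_adicCompletionIntegers L hcδ hδ v hδu'
      ((HeightOneSpectrum.mem_adicCompletionIntegers _ _ _).2 ha1) ((HeightOneSpectrum.mem_adicCompletionIntegers _ _ _).2 hb1) w
    rw [ha, hb, Prod.mk.eta, ContinuousLinearEquiv.apply_symm_apply] at hmem
    exact (HeightOneSpectrum.mem_adicCompletionIntegers _ _ _).1 hmem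
  have hI : ∫ p : Fin 3 → v.adicCompletion ↥(maximalRealSubfield L), ((((∏ w' : PlacesOver L v, max 1 (max ((normAbs (w'.1.adicCompletion L) (quadraticLocalEquiv L v (IsCMField.complexConj L) hcδ hδ (p 0, p 1) w') : ℝ≥0) : ℝ)
          ((normAbs (w'.1.adicCompletion L) ((toLocalRing L v (p 2) * algebraMap L (LocalRing L v) δ -
            toLocalRing L v 2⁻¹ * (quadraticLocalEquiv L v (IsCMField.complexConj L) hcδ hδ (p 0, p 1) *
              conjLocal L (IsCMField.complexConj L) v (quadraticLocalEquiv L v (IsCMField.complexConj L) hcδ hδ (p 0, p 1)))) w') : ℝ≥0) : ℝ))) : ℝ) : ℂ) ^ (-z)) *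
          (∏ w' : PlacesOver L v, (adeleAddCharAt L w'.1 (ξw w' * quadraticLocalEquiv L v (IsCMField.complexConj L) hcδ hδ (p 0, p 1) w') : ℂ)) ∂(Measure.pi fun _ : Fin 3 => ν) = 0 := by
    rw [integral_congr_ae (ae_of_all _ fun p => token_integrand_eq_inertCell_of_nonsplit L hcδ hδ hd v w hw he h2 hδu hq ξw z p)]
    by_cases ha1 : Valued.v a ≤ 1
    · have hb1 : ¬ Valued.v b ≤ 1 := fun hb1 => hab ⟨ha1, hb1⟩
      have hdb : (d : v.adicCompletion ↥(maximalRealSubfield L)) * b ∉ primePowBall (v.adicCompletion ↥(maximalRealSubfield L)) 0 := by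
        rw [mem_primePowBall_zero_iff, map_mul, hdu, one_mul]
        exact hb1
      exact integral_whittakerInertCell_pi_eq_zero_of_not_mem_right ν _ hχ a hdb z
    · have ha' : a ∉ primePowBall (v.adicCompletion ↥(maximalRealSubfield L)) 0 := by rw [mem_primePowBall_zero_iff]; exact ha1
      exact integral_whittakerInertCell_pi_eq_zero_of_not_mem_left ν hχ _ ha' _ z
  rw [hI, smul_zero]

end Nonsplit

/-! ## §2 Split places: the token's integrand is ★ B-split's cell integrand, and the token vanishes on the window for a non-integral frequency -/

section Split

include hd in
/-- **THE TOKEN'S INTEGRAND AT A SPLIT PLACE IS ★ B-SPLIT'S CELL INTEGRAND** at the frequencies `(a₁, −a₂)`, `a₁ = a_w(ξw)`, `a₂ = a_w̄(ξw)` (★ `splitCoord`): `Q_v = A·B` (★ (3-iii) split),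
`X_w = ι_w(p₀ + s p₁)`, `X_w̄ = ι_w̄(p₀ − s p₁)` (★), `ψ_w(ι_w(a₁)·ι_w(x)) = χ_w(x·a₁)`. [cite: Casselman1980, Thm. 3.1] [cite: TateThesis1967, §3.3] -/
theorem token_integrand_eq_splitCell_of_split (hw : IsCMField.complexConj L • w.1 ≠ w.1)
    (ξw : ∀ w' : PlacesOver L v, w'.1.adicCompletion L) (z : ℂ) (p : Fin 3 → v.adicCompletion ↥(maximalRealSubfield L)) :
    ((((∏ w' : PlacesOver L v, max 1 (max ((normAbs (w'.1.adicCompletion L) (quadraticLocalEquiv L v (IsCMField.complexConj L) hcδ hδ (p 0, p 1) w') : ℝ≥0) : ℝ)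
          ((normAbs (w'.1.adicCompletion L) ((toLocalRing L v (p 2) * algebraMap L (LocalRing L v) δ -
            toLocalRing L v 2⁻¹ * (quadraticLocalEquiv L v (IsCMField.complexConj L) hcδ hδ (p 0, p 1) *
              conjLocal L (IsCMField.complexConj L) v (quadraticLocalEquiv L v (IsCMField.complexConj L) hcδ hδ (p 0, p 1)))) w') : ℝ≥0) : ℝ))) : ℝ) : ℂ) ^ (-z)) *
          (∏ w' : PlacesOver L v, (adeleAddCharAt L w'.1 (ξw w' * quadraticLocalEquiv L v (IsCMField.complexConj L) hcδ hδ (p 0, p 1) w') : ℂ)) =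
      (fun q : Fin 3 → v.adicCompletion ↥(maximalRealSubfield L) =>
          ((max 1 (max ((normAbs (v.adicCompletion ↥(maximalRealSubfield L)) (q 0) : ℝ≥0) : ℝ) ((normAbs (v.adicCompletion ↥(maximalRealSubfield L)) (q 2) : ℝ≥0) : ℝ)) : ℝ) : ℂ) ^ (-z) *
            (((max 1 (max ((normAbs (v.adicCompletion ↥(maximalRealSubfield L)) (q 1) : ℝ≥0) : ℝ)
              ((normAbs (v.adicCompletion ↥(maximalRealSubfield L)) (q 2 - q 0 * q 1) : ℝ≥0) : ℝ)) : ℝ) : ℂ) ^ (-z) *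
              (((adeleAddCharAt L (PlacesOver.galInv (IsCMField.complexConj L) w).1).compAddMonoidHom (toPlace v (PlacesOver.galInv (IsCMField.complexConj L) w) : v.adicCompletion ↥(maximalRealSubfield L) →+* (PlacesOver.galInv (IsCMField.complexConj L) w).1.adicCompletion L).toAddMonoidHom (q 1 * -splitCoord ↥(maximalRealSubfield L) L (IsCMField.complexConj L) hcδ hδ v (PlacesOver.galInv (IsCMField.complexConj L) w) ξw) : Circle) : ℂ)) *
            (((adeleAddCharAt L w.1).compAddMonoidHom (toPlace v w : v.adicCompletion ↥(maximalRealSubfield L) →+* w.1.adicCompletion L).toAddMonoidHom (q 0 * splitCoord ↥(maximalRealSubfield L) L (IsCMField.complexConj L) hcδ hδ v w ξw) : Circle) : ℂ))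
        ![p 0 + splitSqrt ↥(maximalRealSubfield L) L (IsCMField.complexConj L) hcδ hδ v w * p 1,
          -(p 0 - splitSqrt ↥(maximalRealSubfield L) L (IsCMField.complexConj L) hcδ hδ v w * p 1),
          splitSqrt ↥(maximalRealSubfield L) L (IsCMField.complexConj L) hcδ hδ v w * p 2 -
            2⁻¹ * (p 0 + splitSqrt ↥(maximalRealSubfield L) L (IsCMField.complexConj L) hcδ hδ v w * p 1) *
              (p 0 - splitSqrt ↥(maximalRealSubfield L) L (IsCMField.complexConj L) hcδ hδ v w * p 1)] := by
  classical
  haveI : Algebra.IsQuadraticExtension ↥(maximalRealSubfield L) L := IsCMField.isQuadraticExtension L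
  have hc1 : IsCMField.complexConj L ≠ 1 := ne_one_of_apply_eq_neg L (IsCMField.complexConj L) hcδ hδ
  have hw' : IsCMField.complexConj L • (PlacesOver.galInv (IsCMField.complexConj L) w).1 ≠ (PlacesOver.galInv (IsCMField.complexConj L) w).1 :=
    smul_galInv_ne L (IsCMField.complexConj L) hcδ hδ v w hw
  have hne : PlacesOver.galInv (IsCMField.complexConj L) w ≠ w := PlacesOver.galInv_ne (IsCMField.complexConj L) w hw
  have huniv : (Finset.univ : Finset (PlacesOver L v)) = {w, PlacesOver.galInv (IsCMField.complexConj L) w} := by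
    ext w''
    simp only [Finset.mem_univ, Finset.mem_insert, Finset.mem_singleton, true_iff]
    exact PlacesOver.eq_or_eq_galInv (IsCMField.complexConj L) hc1 w w''
  -- the height: `Q_v = A·B`, split into complex powers
  rw [prod_placesOver_max_one_norm_height_eq_gl3_of_split L (IsCMField.complexConj L) hcδ hδ hd v w hw (p 0) (p 1) (p 2), Complex.ofReal_mul,
    Complex.mul_cpow_ofReal_nonneg (zero_le_one.trans (le_max_left _ _)) (zero_le_one.trans (le_max_left _ _))]
  -- the characters over the two places
  have hprodχ : (∏ w'' : PlacesOver L v, (adeleAddCharAt L w''.1 (ξw w'' * quadraticLocalEquiv L v (IsCMField.complexConj L) hcδ hδ (p 0, p 1) w'') : ℂ)) =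
      (((adeleAddCharAt L w.1).compAddMonoidHom (toPlace v w : v.adicCompletion ↥(maximalRealSubfield L) →+* w.1.adicCompletion L).toAddMonoidHom ((p 0 + splitSqrt ↥(maximalRealSubfield L) L (IsCMField.complexConj L) hcδ hδ v w * p 1) *
          splitCoord ↥(maximalRealSubfield L) L (IsCMField.complexConj L) hcδ hδ v w ξw) : Circle) : ℂ) *
        (((adeleAddCharAt L (PlacesOver.galInv (IsCMField.complexConj L) w).1).compAddMonoidHom (toPlace v (PlacesOver.galInv (IsCMField.complexConj L) w) : v.adicCompletion ↥(maximalRealSubfield L) →+* (PlacesOver.galInv (IsCMField.complexConj L) w).1.adicCompletion L).toAddMonoidHom ((-(p 0 - splitSqrt ↥(maximalRealSubfield L) L (IsCMField.complexConj L) hcδ hδ v w * p 1)) *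
          -splitCoord ↥(maximalRealSubfield L) L (IsCMField.complexConj L) hcδ hδ v (PlacesOver.galInv (IsCMField.complexConj L) w) ξw) : Circle) : ℂ) := by
    rw [show (∏ w'' : PlacesOver L v, (adeleAddCharAt L w''.1 (ξw w'' * quadraticLocalEquiv L v (IsCMField.complexConj L) hcδ hδ (p 0, p 1) w'') : ℂ)) =
        ∏ w'' ∈ (Finset.univ : Finset (PlacesOver L v)), (adeleAddCharAt L w''.1 (ξw w'' * quadraticLocalEquiv L v (IsCMField.complexConj L) hcδ hδ (p 0, p 1) w'') : ℂ) from rfl,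
      huniv, Finset.prod_pair hne.symm,
      quadraticLocalEquiv_apply_eq_toPlace_of_split L (IsCMField.complexConj L) hcδ hδ hd v w hw,
      quadraticLocalEquiv_apply_galInv_eq_toPlace_of_split L (IsCMField.complexConj L) hcδ hδ hd v w hw,
      ← toPlace_splitCoord ↥(maximalRealSubfield L) L (IsCMField.complexConj L) hcδ hδ hd v w hw ξw,
      ← toPlace_splitCoord ↥(maximalRealSubfield L) L (IsCMField.complexConj L) hcδ hδ hd v (PlacesOver.galInv (IsCMField.complexConj L) w) hw' ξw,
      ← map_mul, ← map_mul, charComp_apply, charComp_apply, neg_mul_neg,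
      mul_comm _ (splitCoord ↥(maximalRealSubfield L) L (IsCMField.complexConj L) hcδ hδ v w ξw),
      mul_comm _ (splitCoord ↥(maximalRealSubfield L) L (IsCMField.complexConj L) hcδ hδ v (PlacesOver.galInv (IsCMField.complexConj L) w) ξw)]
  rw [hprodχ]
  simp only [Matrix.cons_val_zero, Matrix.cons_val_one, Matrix.cons_val_two, Matrix.head_cons, Matrix.tail_cons]
  ring

variable [MeasurableSpace (v.adicCompletion ↥(maximalRealSubfield L))] [BorelSpace (v.adicCompletion ↥(maximalRealSubfield L))]
  (ν : Measure (v.adicCompletion ↥(maximalRealSubfield L))) [ν.IsAddHaarMeasure]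

include hd in
/-- **THE TOKEN VANISHES ON THE WINDOW AT A GOOD SPLIT PLACE ABOVE WHICH THE FREQUENCY IS NOT INTEGRAL** (`|2|_v = 1`, `δ_w` a unit, `χ_w`, `χ_w̄` of conductor exponent `0`; `ξw_w ∉ 𝒪_w`
or `ξw_w̄ ∉ 𝒪_w̄`; `1 < Re z`): §2 + ★ B-split's window package (`Wc = 0` off the box) + `μ(𝒪_v) > 0`. [cite: Casselman1980, Thm. 3.1] [cite: TateThesis1967, §3.3] -/
theorem token_eq_zero_of_split (hw : IsCMField.complexConj L • w.1 ≠ w.1) (h2 : Valued.v (2 : v.adicCompletion ↥(maximalRealSubfield L)) = 1)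
    (hδu : Valued.v (algebraMap L (LocalRing L v) δ w) = 1) (hχ : ((adeleAddCharAt L w.1).compAddMonoidHom (toPlace v w : v.adicCompletion ↥(maximalRealSubfield L) →+* w.1.adicCompletion L).toAddMonoidHom).HasConductorExp 0) (hχ' : ((adeleAddCharAt L (PlacesOver.galInv (IsCMField.complexConj L) w).1).compAddMonoidHom (toPlace v (PlacesOver.galInv (IsCMField.complexConj L) w) : v.adicCompletion ↥(maximalRealSubfield L) →+* (PlacesOver.galInv (IsCMField.complexConj L) w).1.adicCompletion L).toAddMonoidHom).HasConductorExp 0)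
    (ξw : ∀ w' : PlacesOver L v, w'.1.adicCompletion L) (hξ : ¬ Valued.v (ξw w) ≤ 1 ∨ ¬ Valued.v (ξw (PlacesOver.galInv (IsCMField.complexConj L) w)) ≤ 1)
    {z : ℂ} (hz : 1 < z.re) :
    ((Measure.pi fun _ : Fin 3 => ν) (integralBox ↥(maximalRealSubfield L) (Fin 3) v)).toReal⁻¹ •
      ∫ p : Fin 3 → v.adicCompletion ↥(maximalRealSubfield L),
        ((((∏ w' : PlacesOver L v, max 1 (max ((normAbs (w'.1.adicCompletion L) (quadraticLocalEquiv L v (IsCMField.complexConj L) hcδ hδ (p 0, p 1) w') : ℝ≥0) : ℝ)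
          ((normAbs (w'.1.adicCompletion L) ((toLocalRing L v (p 2) * algebraMap L (LocalRing L v) δ -
            toLocalRing L v 2⁻¹ * (quadraticLocalEquiv L v (IsCMField.complexConj L) hcδ hδ (p 0, p 1) *
              conjLocal L (IsCMField.complexConj L) v (quadraticLocalEquiv L v (IsCMField.complexConj L) hcδ hδ (p 0, p 1)))) w') : ℝ≥0) : ℝ))) : ℝ) : ℂ) ^ (-z)) *
          (∏ w' : PlacesOver L v, (adeleAddCharAt L w'.1 (ξw w' * quadraticLocalEquiv L v (IsCMField.complexConj L) hcδ hδ (p 0, p 1) w') : ℂ))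
        ∂(Measure.pi fun _ : Fin 3 => ν) = 0 := by
  haveI : Algebra.IsQuadraticExtension ↥(maximalRealSubfield L) L := IsCMField.isQuadraticExtension L
  have hw' : IsCMField.complexConj L • (PlacesOver.galInv (IsCMField.complexConj L) w).1 ≠ (PlacesOver.galInv (IsCMField.complexConj L) w).1 :=
    smul_galInv_ne L (IsCMField.complexConj L) hcδ hδ v w hw
  -- `‖s‖ = ‖2‖ = 1`
  have hval : Valued.v (splitSqrt ↥(maximalRealSubfield L) L (IsCMField.complexConj L) hcδ hδ v w) = 1 := by
    rw [← valued_toPlace_of_split ↥(maximalRealSubfield L) L (IsCMField.complexConj L) v w hw (splitSqrt ↥(maximalRealSubfield L) L (IsCMField.complexConj L) hcδ hδ v w),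
      toPlace_splitSqrt ↥(maximalRealSubfield L) L (IsCMField.complexConj L) hcδ hδ hd v w hw]
    exact hδu
  have hδ1 : normAbs (v.adicCompletion ↥(maximalRealSubfield L)) (splitSqrt ↥(maximalRealSubfield L) L (IsCMField.complexConj L) hcδ hδ v w) = 1 :=
    le_antisymm (by rw [← map_one (normAbs (v.adicCompletion ↥(maximalRealSubfield L))), normAbs_le_normAbs_iff_valued, hval, Valuation.map_one])
      (by rw [← map_one (normAbs (v.adicCompletion ↥(maximalRealSubfield L))), normAbs_le_normAbs_iff_valued, hval, Valuation.map_one])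
  have h2' : normAbs (v.adicCompletion ↥(maximalRealSubfield L)) (2 : v.adicCompletion ↥(maximalRealSubfield L)) = 1 :=
    le_antisymm (by rw [← map_one (normAbs (v.adicCompletion ↥(maximalRealSubfield L))), normAbs_le_normAbs_iff_valued, h2, Valuation.map_one])
      (by rw [← map_one (normAbs (v.adicCompletion ↥(maximalRealSubfield L))), normAbs_le_normAbs_iff_valued, h2, Valuation.map_one])
  obtain ⟨Wc, -, hi, -, -, hsupp⟩ := exists_window_splitWhittakerPackage_pi ν hδ1 h2' (continuous_charComp L v w) (continuous_charComp L v (PlacesOver.galInv (IsCMField.complexConj L) w))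
    hχ hχ' (splitCoord ↥(maximalRealSubfield L) L (IsCMField.complexConj L) hcδ hδ v w ξw)
    (-splitCoord ↥(maximalRealSubfield L) L (IsCMField.complexConj L) hcδ hδ v (PlacesOver.galInv (IsCMField.complexConj L) w) ξw)
  have h0 : Wc = 0 := by
    refine hsupp ?_
    rcases hξ with h | h
    · left
      rw [mem_primePowBall_zero_iff, valued_splitCoord ↥(maximalRealSubfield L) L (IsCMField.complexConj L) hcδ hδ hd v w hw ξw]
      exact h
    · right
      rw [mem_primePowBall_zero_iff, Valuation.map_neg, valued_splitCoord ↥(maximalRealSubfield L) L (IsCMField.complexConj L) hcδ hδ hd v (PlacesOver.galInv (IsCMField.complexConj L) w) hw' ξw]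
      exact h
  have hint := hi z hz
  rw [h0, Pi.zero_apply] at hint
  have hc0 : ((ν.real (primePowBall (v.adicCompletion ↥(maximalRealSubfield L)) 0) : ℂ)⁻¹) ^ 3 ≠ 0 :=
    pow_ne_zero _ (inv_ne_zero (by exact_mod_cast (measureReal_primePowBall_pos ν 0).ne'))
  have hI : ∫ p : Fin 3 → v.adicCompletion ↥(maximalRealSubfield L), ((((∏ w' : PlacesOver L v, max 1 (max ((normAbs (w'.1.adicCompletion L) (quadraticLocalEquiv L v (IsCMField.complexConj L) hcδ hδ (p 0, p 1) w') : ℝ≥0) : ℝ)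
          ((normAbs (w'.1.adicCompletion L) ((toLocalRing L v (p 2) * algebraMap L (LocalRing L v) δ -
            toLocalRing L v 2⁻¹ * (quadraticLocalEquiv L v (IsCMField.complexConj L) hcδ hδ (p 0, p 1) *
              conjLocal L (IsCMField.complexConj L) v (quadraticLocalEquiv L v (IsCMField.complexConj L) hcδ hδ (p 0, p 1)))) w') : ℝ≥0) : ℝ))) : ℝ) : ℂ) ^ (-z)) *
          (∏ w' : PlacesOver L v, (adeleAddCharAt L w'.1 (ξw w' * quadraticLocalEquiv L v (IsCMField.complexConj L) hcδ hδ (p 0, p 1) w') : ℂ)) ∂(Measure.pi fun _ : Fin 3 => ν) = 0 := by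
    rw [integral_congr_ae (ae_of_all _ fun p => token_integrand_eq_splitCell_of_split L hcδ hδ hd v w hw ξw z p)]
    exact (mul_eq_zero.1 hint).resolve_left hc0
  rw [hI, smul_zero]

end Split

/-! ## §3 Every good place; the letter `hvan` of ★ F3 at the trivial box -/

section Good

variable [MeasurableSpace (v.adicCompletion ↥(maximalRealSubfield L))] [BorelSpace (v.adicCompletion ↥(maximalRealSubfield L))]
  (ν : Measure (v.adicCompletion ↥(maximalRealSubfield L))) [ν.IsAddHaarMeasure]

include hd in
/-- **THE TOKEN VANISHES ON THE WINDOW AT EVERY GOOD PLACE ABOVE WHICH THE FREQUENCY IS NOT INTEGRAL** (`v` unramified in `L`, `|2|_v = 1`, all `δ_w` and `d` units, all `χ_w` of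
conductor exponent `0`; `ξw_{w₀} ∉ 𝒪_{w₀}` for some `w₀ ∣ v`; `1 < Re z`): §1 if `w₀` is non-split, §2 if it is split. [cite: TateThesis1967, §3.3] [cite: Casselman1980, Thm. 3.1] -/
theorem token_eq_zero_of_good (hunr : Algebra.IsUnramifiedIn (𝓞 L) v.asIdeal) (h2 : Valued.v (2 : v.adicCompletion ↥(maximalRealSubfield L)) = 1)
    (hδu : ∀ w' : PlacesOver L v, Valued.v (algebraMap L (LocalRing L v) δ w') = 1) (hdu : Valued.v ((d : v.adicCompletion ↥(maximalRealSubfield L))) = 1)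
    (hχ : ∀ w' : PlacesOver L v, ((adeleAddCharAt L w'.1).compAddMonoidHom (toPlace v w' : v.adicCompletion ↥(maximalRealSubfield L) →+* w'.1.adicCompletion L).toAddMonoidHom).HasConductorExp 0)
    (ξw : ∀ w' : PlacesOver L v, w'.1.adicCompletion L) (w₀ : PlacesOver L v) (hξ : ¬ Valued.v (ξw w₀) ≤ 1) {z : ℂ} (hz : 1 < z.re) :
    ((Measure.pi fun _ : Fin 3 => ν) (integralBox ↥(maximalRealSubfield L) (Fin 3) v)).toReal⁻¹ •
      ∫ p : Fin 3 → v.adicCompletion ↥(maximalRealSubfield L),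
        ((((∏ w' : PlacesOver L v, max 1 (max ((normAbs (w'.1.adicCompletion L) (quadraticLocalEquiv L v (IsCMField.complexConj L) hcδ hδ (p 0, p 1) w') : ℝ≥0) : ℝ)
          ((normAbs (w'.1.adicCompletion L) ((toLocalRing L v (p 2) * algebraMap L (LocalRing L v) δ -
            toLocalRing L v 2⁻¹ * (quadraticLocalEquiv L v (IsCMField.complexConj L) hcδ hδ (p 0, p 1) *
              conjLocal L (IsCMField.complexConj L) v (quadraticLocalEquiv L v (IsCMField.complexConj L) hcδ hδ (p 0, p 1)))) w') : ℝ≥0) : ℝ))) : ℝ) : ℂ) ^ (-z)) *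
          (∏ w' : PlacesOver L v, (adeleAddCharAt L w'.1 (ξw w' * quadraticLocalEquiv L v (IsCMField.complexConj L) hcδ hδ (p 0, p 1) w') : ℂ))
        ∂(Measure.pi fun _ : Fin 3 => ν) = 0 := by
  by_cases hw₀ : IsCMField.complexConj L • w₀.1 = w₀.1
  · obtain ⟨he, hq⟩ := placesOver_good L v hunr w₀
    exact token_eq_zero_of_nonsplit L hcδ hδ hd v w₀ ν hw₀ he h2 (hδu w₀) (hq hw₀) hdu (hχ w₀) ξw hξ z
  · exact token_eq_zero_of_split L hcδ hδ hd v w₀ ν hw₀ h2 (hδu w₀) (hχ w₀) (hχ _) ξw (Or.inl hξ) hz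

end Good

section Letter

variable {L}

include hd in
/-- **THE LETTER `hvan` OF ★ F3 `exists_whittaker_letters_cm_three_of` AT A GOOD PLACE, TRIVIAL BOX** (`e_w = 0`): for `ξ ∈ L` and a place `w` of `L` above the good place `v = w.under`
with `(ξ : L_w) ∉ 𝔭_w^0`, the token at `w.under` with the frequency vector `w' ↦ (ξ : L_{w'})` vanishes for `1 < Re z` (§3 with `w₀ = w`). [cite: TateThesis1967, §3.3] [cite: MoeglinWaldspurger1995, I.2.10] -/
theorem token_under_eq_zero_of_not_mem (ξ : L) (w : HeightOneSpectrum (𝓞 L))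
    [MeasurableSpace ((w.under (𝓞 ↥(maximalRealSubfield L))).adicCompletion ↥(maximalRealSubfield L))] [BorelSpace ((w.under (𝓞 ↥(maximalRealSubfield L))).adicCompletion ↥(maximalRealSubfield L))]
    (ν : Measure ((w.under (𝓞 ↥(maximalRealSubfield L))).adicCompletion ↥(maximalRealSubfield L))) [ν.IsAddHaarMeasure]
    (hunr : Algebra.IsUnramifiedIn (𝓞 L) (w.under (𝓞 ↥(maximalRealSubfield L))).asIdeal) (h2 : Valued.v (2 : (w.under (𝓞 ↥(maximalRealSubfield L))).adicCompletion ↥(maximalRealSubfield L)) = 1)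
    (hδu : ∀ w' : PlacesOver L (w.under (𝓞 ↥(maximalRealSubfield L))), Valued.v (algebraMap L (LocalRing L (w.under (𝓞 ↥(maximalRealSubfield L)))) δ w') = 1)
    (hdu : Valued.v ((d : (w.under (𝓞 ↥(maximalRealSubfield L))).adicCompletion ↥(maximalRealSubfield L))) = 1)
    (hχ : ∀ w' : PlacesOver L (w.under (𝓞 ↥(maximalRealSubfield L))), ((adeleAddCharAt L w'.1).compAddMonoidHom
      (toPlace (w.under (𝓞 ↥(maximalRealSubfield L))) w' : (w.under (𝓞 ↥(maximalRealSubfield L))).adicCompletion ↥(maximalRealSubfield L) →+* w'.1.adicCompletion L).toAddMonoidHom).HasConductorExp 0)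
    (hξ : (ξ : w.adicCompletion L) ∉ primePowBall (w.adicCompletion L) 0) {z : ℂ} (hz : 1 < z.re) :
    ((Measure.pi fun _ : Fin 3 => ν) (integralBox ↥(maximalRealSubfield L) (Fin 3) (w.under (𝓞 ↥(maximalRealSubfield L))))).toReal⁻¹ •
      ∫ p : Fin 3 → (w.under (𝓞 ↥(maximalRealSubfield L))).adicCompletion ↥(maximalRealSubfield L),
        ((((∏ w' : PlacesOver L (w.under (𝓞 ↥(maximalRealSubfield L))), max 1 (max ((normAbs (w'.1.adicCompletion L) (quadraticLocalEquiv L (w.under (𝓞 ↥(maximalRealSubfield L))) (IsCMField.complexConj L) hcδ hδ (p 0, p 1) w') : ℝ≥0) : ℝ)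
          ((normAbs (w'.1.adicCompletion L) ((toLocalRing L (w.under (𝓞 ↥(maximalRealSubfield L))) (p 2) * algebraMap L (LocalRing L (w.under (𝓞 ↥(maximalRealSubfield L)))) δ -
            toLocalRing L (w.under (𝓞 ↥(maximalRealSubfield L))) 2⁻¹ * (quadraticLocalEquiv L (w.under (𝓞 ↥(maximalRealSubfield L))) (IsCMField.complexConj L) hcδ hδ (p 0, p 1) *
              conjLocal L (IsCMField.complexConj L) (w.under (𝓞 ↥(maximalRealSubfield L))) (quadraticLocalEquiv L (w.under (𝓞 ↥(maximalRealSubfield L))) (IsCMField.complexConj L) hcδ hδ (p 0, p 1)))) w') : ℝ≥0) : ℝ))) : ℝ) : ℂ) ^ (-z)) *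
          (∏ w' : PlacesOver L (w.under (𝓞 ↥(maximalRealSubfield L))), (adeleAddCharAt L w'.1 (((ξ : w'.1.adicCompletion L)) * quadraticLocalEquiv L (w.under (𝓞 ↥(maximalRealSubfield L))) (IsCMField.complexConj L) hcδ hδ (p 0, p 1) w') : ℂ))
        ∂(Measure.pi fun _ : Fin 3 => ν) = 0 := by
  have hξ' : ¬ Valued.v ((fun w' : PlacesOver L (w.under (𝓞 ↥(maximalRealSubfield L))) => ((ξ : w'.1.adicCompletion L))) ⟨w, rfl⟩) ≤ 1 := by
    rw [mem_primePowBall_adicCompletion_iff, neg_zero, WithZero.exp_zero] at hξ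
    exact hξ
  exact token_eq_zero_of_good L hcδ hδ hd (w.under (𝓞 ↥(maximalRealSubfield L))) ν hunr h2 hδu hdu hχ (fun w' => ((ξ : w'.1.adicCompletion L))) ⟨w, rfl⟩ hξ' hz

end Letter

end Summit.HodgeConjecture.HodgeConjecture.Cruxes.H413.K2E1WhittakerTokenSupportU3

end
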